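import Literature.NumberTheory.GelbartRogawski1991.UnitaryDualPairThetaKernelCM
import Literature.NumberTheory.Weil1964.ArchDualPairThetaMajorants
import Literature.NumberTheory.Weil1964.AdelicThetaGaussian
import HarnessLib

-- buildfix 2026-08-21 (ops-buildfix-2, LEDGER G11b-3): elaborate this file SEQUENTIALLY on the build lane.
-- Its theorems carry ≈130 s of kernel checking; run as parallel tasks under `lake build` the job never
-- returned (batches 1.122/1.124/1.125/1.127 killed) — same class as the B11-4 repair. Statements unchanged.
set_option Elab.async false
-- buildfix G11b-3 (ops-buildfix-3 g13, 2026-08-21): the `unusedSectionVars` linter costs ≈8.5 s and a large transient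
-- allocation PER THEOREM here (the section binders `hρ`/`hSK` have very large elaborated types): 13 theorems ⇒ 110 of
-- the 131 s elaboration measured on the farm, and the hub build lane stalled/ran out of memory on exactly this module in
-- six consecutive stream-1 batches. All section variables of §3/§4 ARE used (they appear in the statements); lint debt only.
set_option linter.unusedSectionVars false

/-!
# The theta kernel of a unitary dual pair does not vanish: the Gaussian at the identity (`U(1) × U(1)` included)

Topic `NumberTheory/GelbartRogawski1991`; namespace `Literature.NumberTheory.GelbartRogawski1991.UnitaryDualPair`
(continues `UnitaryDualPairThetaKernel`, `UnitaryDualPairThetaKernelCM`).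

KERNEL file (no definition, no new named fact, no hypothesis record, no `sorry`): the NON-VACUITY INSTANCE of the
constructed theta-kernel datum of a unitary dual pair `U(J_V) × U(J_W)` over a quadratic extension `E/F`
(`UnitaryDualPair.thetaKernelDatum`; CM currency `UnitaryDualPair.cmThetaKernelDatum`) demanded by the Layer-C
definitions tribunal of the lane `lit-hodgefound` (TRIBUNAL-C V-C2.i / DAG-C P-C2-03): a Schwartz–Bruhat function and an
argument at which the theta kernel `θ_Φ(g, h) = Σ_{ξ ∈ 𝕏(F)} (ω_ψ(s(g, h))Φ)(ξ)` ([Weil1964, n° 41 Thm 6 p. 193];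
[GelbartRogawski1991, §3.2 p. 457]) is a convergent, explicitly identified, NON-ZERO series.

In the tree's Schrödinger model the Weil representation `ω_ψ` of `Mp_ψ(𝕎_𝔸)ᶜᵒⁿᵗ`, `𝕎 = Res_{E/F}(V ⊗_E W) = 𝕏 ⊕ 𝕏*`,
`𝕏 = Fⁿ` (`n = NM`), acts on `𝒮(𝔸_Fⁿ) = piSchwartzBruhat F (Fin n)`, and the kernel at `(g, h)` is Weil's theta
DISTRIBUTION `Θ(Φ') = Σ_{ξ ∈ Fⁿ} Φ'(ξ)` of `Φ' = ω_ψ(s_pair(g⁻¹, h⁻¹))Φ` (`thetaKernelDatum_thetaFun_mk_eq_tsum`).  The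
test function is THE ADELIC GAUSSIAN `Φ_G = gaussSB F n = e^{-‖T z_∞‖²} ⊗ 𝟙_{𝒪̂ⁿ}` of `Weil1964/AdelicThetaGaussian`,
whose theta distribution is the classical theta series `Σ_{ξ ∈ 𝓞_Fⁿ} e^{-Q(ξ)} ≥ 1` of the positive-definite norm
form `Q = gaussNormSq F n` on the lattice `𝓞_Fⁿ ⊂ (F ⊗ ℝ)ⁿ` (`thetaDist_gaussSB_eq_tsum`, `one_le_re_thetaDist_gaussSB`).

* §2 THE KERNEL AT THE IDENTITY, for the constructed datum at ANY compatible splitting `s` and ANY `(N, M)`: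
  `θ_Φ(1, 1) = Θ(Φ) = Σ_{ξ ∈ Fⁿ} Φ(ξ)` (`thetaKernelDatum_thetaFun_one`, `…_eq_tsum` = the tree's
  `thetaKernelDatum_thetaFun_mk_eq_tsum` specialised, and the `HasSum` form `thetaKernelDatum_hasSum_thetaFun_one`:
  the series CONVERGES absolutely); at the Gaussian **`θ_{Φ_G}(1, 1) = Σ_{ξ ∈ 𝓞_Fⁿ} e^{-Q(ξ)}`**
  (`thetaKernelDatum_thetaFun_gaussSB_one`, `…_hasSum_…`), `Re ≥ 1`, hence **`θ_{Φ_G}(1, 1) ≠ 0`**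
  (`thetaKernelDatum_thetaFun_gaussSB_one_ne_zero`); the same for the descended kernel `thetaKer` on
  `[U(J_V)] × [U(J_W)]` at the base point, and — over COMPACT quotients with a finite Borel measure charging open sets —
  the THETA LIFT `Θ_{Φ_G}(f)`, `f = conj θ_{Φ_G}(1̄, ·)`, does not vanish at `1̄`
  (`thetaKernelDatum_thetaLift_gaussSB_ne_zero`, via `ThetaKernelDatum.thetaLift_star_slice_ne_zero`).
* §3 the same statements in the CM currency (`cmThetaKernelDatum`, `F = L⁺`, `E = L`, `c` = complex conjugation).
* §4 THE `U(1) × U(1)` INSTANCE (`N = M = 1`, the hermitian lines `⟨1⟩`, `⟨1⟩` over a CM extension `L/L⁺`, `n = 1`,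
  `𝕏 = L⁺`): the theta kernel of the Gaussian at the identity is the theta series `Σ_{ξ ∈ 𝓞_{L⁺}} e^{-Q(ξ)}` of the
  positive-definite norm form `Q(ξ) = ‖T j(ξ)‖²` on the lattice `𝓞_{L⁺} ⊂ L⁺ ⊗ ℝ` — convergent, of real part `≥ 1`,
  non-zero (`cmThetaKernelDatum_U1U1_thetaFun_gaussSB_one`, `…_hasSum_…`, `…_ne_zero`, descended form
  `cmThetaKernelDatum_U1U1_thetaKer_gaussSB_one_ne_zero`).  For this pair Weil's majorants `hρ` are SUPPLIED by the
  tree (`hasThetaMajorants_cmPairSplitting_U1U1`, from `Weil1964.hasThetaMajorants_cmPairSplitting_of_signs`: the lines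
  `⟨1⟩` are definite through every complex embedding) and `SK := univ` is admissible, so the datum
  `cmThetaKernelDatum L e 1 ⋯ 1 ⋯ hGR (hasThetaMajorants_cmPairSplitting_U1U1 L e hGR) univ ⋯` and its non-vanishing
  (`cmThetaKernelDatum_U1U1_univ_thetaFun_gaussSB_one`, `…_univ_…_ne_zero`) depend on the ONE cited hypothesis
  `hGR` = [GelbartRogawski1991, Prop. 3.1.1] at this pair (DAG-C C2-03: "α+K modulo the one hypothesis C2-02").

The hypotheses of the constructed datum — a compatible splitting (`hs`; in the CM currency the cited existential
`hGR : CompatibleSplitting` = [GelbartRogawski1991, Prop. 3.1.1] at the pair), Weil's majorants `hρ`, the `K`-type set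
`SK` — stay explicit binders exactly as the datum takes them; the conclusions hold for every choice of them.

## References
* A. Weil, *Sur certains groupes d'opérateurs unitaires*, Acta Math. 111 (1964) 143–211, Chap. III n° 41 Théorème 6
  p. 193 (`Θ(S) = Σ_{ξ ∈ X_k} SΦ(ξ)`) [Weil1964].
* S. Gelbart, J. Rogawski, *L-functions and Fourier–Jacobi coefficients for the unitary group U(3)*, Invent. Math. 105
  (1991) 445–472, §3.2 p. 457 (the theta kernel of the unitary dual pair) [GelbartRogawski1991].
* P. Fleig, H. P. A. Gustafsson, A. Kleinschmidt, D. Persson, *Eisenstein Series and Automorphic Representations* (2018),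
  §12.4 (12.44) (the kernel `θ_φ(g, h)`), Example 12.7 (12.45)–(12.48) (Gaussian `e^{-πx²} ⊗ ∏_p γ_p`: the global theta
  series is the classical Jacobi theta series, the sum restricting to the integers) [FleigEtAl2018].
-/

set_option autoImplicit false

noncomputable section

open scoped Matrix ComplexConjugate
open NumberField NumberField.mixedEmbedding IsDedekindDomain
open _root_.MeasureTheory
open Literature.NumberTheory.Automorphic

/-! ## §2. The theta kernel of the unitary dual pair at the identity -/

namespace Literature.NumberTheory.GelbartRogawski1991

namespace UnitaryDualPair

open Literature.NumberTheory.Weil1964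

section Kernel

variable (F E : Type) [Field F] [NumberField F] [Field E] [NumberField E] [Algebra F E]
variable (c : E ≃ₐ[F] E) (N M : ℕ) {n : ℕ} (e : Fin N × Fin M ≃ Fin n)
variable (JV : Matrix (Fin N) (Fin N) E) (JW : Matrix (Fin M) (Fin M) E)
variable {TV : Matrix (Fin N) (Fin N) F} {TW : Matrix (Fin M) (Fin M) F}
variable [Algebra.IsQuadraticExtension F E] {δ : E} (hcδ : c δ = -δ) (hδ : δ ≠ 0) {d : F}
  (hd : δ * δ = algebraMap F E d) (hV : TV.IsSymm) (hW : TW.IsSymm) (hVd : IsUnit TV.det) (hWd : IsUnit TW.det)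
  (hJV : JV = TV.map (algebraMap F E)) (hJW : JW = TW.map (algebraMap F E))
variable [LocallyCompactSpace (UnitaryGroup.adelic F E c N JV)] [LocallyCompactSpace (UnitaryGroup.adelic F E c M JW)]
variable {s : UnitaryGroup.adelicPair F E c N M JV JW →* adelicMpCont F (Fin n) (adelicGram F e TV TW)}
  (hs : (splittingDatum F E c N M e JV JW hcδ hδ hd hV hW hVd hWd hJV hJW).IsCompatible s)
  (hρ : HasThetaMajorants fun (p : UnitaryGroup.adelic F E c N JV × UnitaryGroup.adelic F E c M JW)
    (Φ : piSchwartzBruhat F (Fin n)) => pairRep F E c N M e JV JW s p Φ)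
  (SK : Set (piSchwartzBruhat F (Fin n)))
  (hSK : ∀ (h : UnitaryGroup.adelic F E c M JW) (Φ : piSchwartzBruhat F (Fin n)), Φ ∈ SK →
    pairRep F E c N M e JV JW s (1, h) Φ ∈ SK)

/-- **At the identity the theta kernel is the theta distribution**: `θ_Φ(1, 1) = Θ(Φ)` (`s_pair(1, 1) = 1`,
`ω_ψ(1) = 1`). [cite: Weil1964, Chap. III n° 41 Thm 6 p. 193] -/
theorem thetaKernelDatum_thetaFun_one (Φ : piSchwartzBruhat F (Fin n)) :
    (thetaKernelDatum F E c N M e JV JW hcδ hδ hd hV hW hVd hWd hJV hJW s hs hρ SK hSK).thetaFun Φ 1 =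
      thetaDistLM F (Fin n) Φ := by
  rw [ThetaKernelDatum.thetaFun_one]
  show thetaDistLM F (Fin n)
    (((pairRep F E c N M e JV JW s).toHomUnits 1 : Module.End ℂ (piSchwartzBruhat F (Fin n))) Φ) = _
  rw [map_one, Units.val_one, Module.End.one_apply]

/-- … as the series over the rational points: **`θ_Φ(1, 1) = Σ_{ξ ∈ Fⁿ} Φ(ξ)`**
(`thetaKernelDatum_thetaFun_mk_eq_tsum` specialised). [cite: Weil1964, Chap. III n° 41, p. 193;
GelbartRogawski1991, §3.2 p. 457] -/
theorem thetaKernelDatum_thetaFun_one_eq_tsum (Φ : piSchwartzBruhat F (Fin n)) :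
    (thetaKernelDatum F E c N M e JV JW hcδ hδ hd hV hW hVd hWd hJV hJW s hs hρ SK hSK).thetaFun Φ 1 =
      ∑' ξ : Fin n → F, (Φ : (Fin n → AdeleRing (𝓞 F) F) → ℂ) (ratPt F (Fin n) ξ) := by
  rw [thetaKernelDatum_thetaFun_one]
  rfl

/-- **Convergence**: the series `Σ_{ξ ∈ Fⁿ} Φ(ξ)` converges (absolutely) to `θ_Φ(1, 1)` for every
`Φ ∈ 𝒮(𝔸_Fⁿ)`. [cite: Weil1964, Chap. III n° 41, Lemme 5 p. 191, Thm 6 p. 193] -/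
theorem thetaKernelDatum_hasSum_thetaFun_one (Φ : piSchwartzBruhat F (Fin n)) :
    HasSum (fun ξ : Fin n → F => (Φ : (Fin n → AdeleRing (𝓞 F) F) → ℂ) (ratPt F (Fin n) ξ))
      ((thetaKernelDatum F E c N M e JV JW hcδ hδ hd hV hW hVd hWd hJV hJW s hs hρ SK hSK).thetaFun Φ 1) := by
  rw [thetaKernelDatum_thetaFun_one]
  exact hasSum_thetaDist Φ.2

/-- **THE GAUSSIAN INSTANCE**: `θ_{Φ_G}(1, 1) = Σ_{ξ ∈ 𝓞_Fⁿ} e^{-Q(ξ)}`, the classical theta series of the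
positive-definite norm form `Q` (`gaussNormSq`) on the lattice `𝓞_Fⁿ` (FGKP Example 12.7: the global theta series of the
Eulerian Gaussian `e^{-πx²} ⊗ ∏_p γ_p` at `h = 1` is the classical Jacobi theta series, the sum over `F` restricting to
the integers). [cite: FleigEtAl2018, §12.4 Example 12.7, (12.44)–(12.48)] -/
theorem thetaKernelDatum_thetaFun_gaussSB_one :
    (thetaKernelDatum F E c N M e JV JW hcδ hδ hd hV hW hVd hWd hJV hJW s hs hρ SK hSK).thetaFun (gaussSB F n) 1 =
      ∑' ζ : Fin n → 𝓞 F, (Real.exp (-gaussNormSq F n ζ) : ℂ) := by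
  rw [thetaKernelDatum_thetaFun_one]
  exact thetaDist_gaussSB_eq_tsum F n

/-- … as a convergent series over the lattice `𝓞_Fⁿ`. [cite: FleigEtAl2018, §12.4 Example 12.7, (12.45)–(12.48)] -/
theorem thetaKernelDatum_hasSum_thetaFun_gaussSB_one :
    HasSum (fun ζ : Fin n → 𝓞 F => (Real.exp (-gaussNormSq F n ζ) : ℂ))
      ((thetaKernelDatum F E c N M e JV JW hcδ hδ hd hV hW hVd hWd hJV hJW s hs hρ SK hSK).thetaFun (gaussSB F n) 1) := by
  rw [thetaKernelDatum_thetaFun_one]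
  exact hasSum_thetaDist_gaussSB_int F n

/-- `Re θ_{Φ_G}(1, 1) ≥ 1` (all terms of the theta series are positive, the term `ξ = 0` is `1`). [cite: FleigEtAl2018, §12.4 Example 12.7, (12.45)–(12.48)] -/
theorem one_le_re_thetaKernelDatum_thetaFun_gaussSB_one :
    1 ≤ ((thetaKernelDatum F E c N M e JV JW hcδ hδ hd hV hW hVd hWd hJV hJW s hs hρ SK hSK).thetaFun
      (gaussSB F n) 1).re := by
  rw [thetaKernelDatum_thetaFun_one]
  exact one_le_re_thetaDist_gaussSB F n

/-- **NON-VANISHING OF THE THETA KERNEL**: `θ_{Φ_G}(1, 1) ≠ 0` for the constructed datum of `U(J_V) × U(J_W)`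
at every compatible splitting. [cite: Weil1964, Chap. III n° 41 Thm 6 p. 193; GelbartRogawski1991, §3.2 p. 457] -/
theorem thetaKernelDatum_thetaFun_gaussSB_one_ne_zero :
    (thetaKernelDatum F E c N M e JV JW hcδ hδ hd hV hW hVd hWd hJV hJW s hs hρ SK hSK).thetaFun (gaussSB F n) 1 ≠ 0 := by
  rw [thetaKernelDatum_thetaFun_one]
  exact thetaDistLM_gaussSB_ne_zero F n

/-- The descended kernel on `[U(J_V)] × [U(J_W)]` at the base point: `θ_{Φ_G}(1̄, 1̄) ≠ 0`. [cite: Weil1964, Chap. III n° 41 Thm 6 p. 193; GelbartRogawski1991, §3.2 p. 457] -/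
theorem thetaKernelDatum_thetaKer_gaussSB_one_ne_zero :
    (thetaKernelDatum F E c N M e JV JW hcδ hδ hd hV hW hVd hWd hJV hJW s hs hρ SK hSK).thetaKer (gaussSB F n)
      (QuotientGroup.mk 1, QuotientGroup.mk 1) ≠ 0 := by
  rw [ThetaKernelDatum.thetaKer_apply, ThetaKernelDatum.thetaQuot_mk]
  exact thetaKernelDatum_thetaFun_gaussSB_one_ne_zero F E c N M e JV JW hcδ hδ hd hV hW hVd hWd hJV hJW hs hρ SK hSK

variable [CompactSpace (UnitaryGroup.adelic F E c N JV ⧸ (UnitaryGroup.toAdelic F E c N JV).range)]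
  [CompactSpace (UnitaryGroup.adelic F E c M JW ⧸ (UnitaryGroup.toAdelic F E c M JW).range)]
  [MeasurableSpace (UnitaryGroup.adelic F E c M JW ⧸ (UnitaryGroup.toAdelic F E c M JW).range)]
  [BorelSpace (UnitaryGroup.adelic F E c M JW ⧸ (UnitaryGroup.toAdelic F E c M JW).range)]
  (μ : Measure (UnitaryGroup.adelic F E c M JW ⧸ (UnitaryGroup.toAdelic F E c M JW).range)) [IsFiniteMeasure μ]
  [μ.IsOpenPosMeasure]

/-- **NON-VANISHING OF A THETA LIFT** (compact quotients, `μ` finite and positive on open sets): the theta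
lift `Θ_{Φ_G}(f)` of `f = conj θ_{Φ_G}(1̄, ·) ∈ C([U(J_W)], ℂ)` satisfies `Θ_{Φ_G}(f)(1̄) = ∫ |θ_{Φ_G}(1̄, q)|² dμ ≠ 0`.
[cite: FleigEtAl2018, §12.3 Definition 12.5 (12.37)] -/
theorem thetaKernelDatum_thetaLift_gaussSB_ne_zero :
    (thetaKernelDatum F E c N M e JV JW hcδ hδ hd hV hW hVd hWd hJV hJW s hs hρ SK hSK).thetaLift μ (gaussSB F n)
      (star ((thetaKernelDatum F E c N M e JV JW hcδ hδ hd hV hW hVd hWd hJV hJW s hs hρ SK hSK).thetaKerSlice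
        (gaussSB F n) (QuotientGroup.mk 1)))
      (QuotientGroup.mk 1) ≠ 0 :=
  ThetaKernelDatum.thetaLift_star_slice_ne_zero _ μ
    (thetaKernelDatum_thetaKer_gaussSB_one_ne_zero F E c N M e JV JW hcδ hδ hd hV hW hVd hWd hJV hJW hs hρ SK hSK)

end Kernel

/-! ## §3. The CM currency (`F = L⁺`, `E = L`, `c` = complex conjugation) -/

section CM

variable (L : Type) [Field L] [NumberField L] [IsCMField L] {N M n : ℕ} (e : Fin N × Fin M ≃ Fin n)
variable (dV : Fin N → L) (hdV : ∀ i, IsCMField.complexConj L (dV i) = dV i) (hdV0 : ∀ i, dV i ≠ 0)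
variable (dW : Fin M → L) (hdW : ∀ i, IsCMField.complexConj L (dW i) = dW i) (hdW0 : ∀ i, dW i ≠ 0)
variable (hGR : (cmSplittingDatum L e dV hdV hdV0 dW hdW hdW0).CompatibleSplitting)
  (hρ : HasThetaMajorants fun
    (p : ↥(UnitaryGroup.adelic (↥(maximalRealSubfield L)) L (IsCMField.complexConj L) N (Matrix.diagonal dV)) ×
      ↥(UnitaryGroup.adelic (↥(maximalRealSubfield L)) L (IsCMField.complexConj L) M (Matrix.diagonal dW)))
    (Φ : piSchwartzBruhat (↥(maximalRealSubfield L)) (Fin n)) =>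
      adelicMpCont.omega (↥(maximalRealSubfield L)) (Fin n)
        (adelicGram (↥(maximalRealSubfield L)) e (realDiagonal L dV hdV) (realDiagonal L dW hdW))
        (cmPairSplitting L e dV hdV hdV0 dW hdW hdW0 hGR p) Φ)
  (SK : Set (piSchwartzBruhat (↥(maximalRealSubfield L)) (Fin n)))
  (hSK : ∀ (h : ↥(UnitaryGroup.adelic (↥(maximalRealSubfield L)) L (IsCMField.complexConj L) M (Matrix.diagonal dW)))
    (Φ : piSchwartzBruhat (↥(maximalRealSubfield L)) (Fin n)), Φ ∈ SK →
      cmPairRep L e dV hdV hdV0 dW hdW hdW0 hGR (1, h) Φ ∈ SK)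

/-- CM currency: **`θ_Φ(1, 1) = Θ(Φ)`** (`s_pair(1, 1) = 1`, `ω_ψ(1) = 1`). [cite: Weil1964, Chap. III n° 41 Thm 6
p. 193] -/
theorem cmThetaKernelDatum_thetaFun_one (Φ : piSchwartzBruhat (↥(maximalRealSubfield L)) (Fin n)) :
    (cmThetaKernelDatum L e dV hdV hdV0 dW hdW hdW0 hGR hρ SK hSK).thetaFun Φ 1 =
      thetaDistLM (↥(maximalRealSubfield L)) (Fin n) Φ := by
  rw [ThetaKernelDatum.thetaFun_one]
  show thetaDistLM (↥(maximalRealSubfield L)) (Fin n)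
    (((cmPairRep L e dV hdV hdV0 dW hdW hdW0 hGR).toHomUnits 1 :
      Module.End ℂ (piSchwartzBruhat (↥(maximalRealSubfield L)) (Fin n))) Φ) = _
  rw [map_one, Units.val_one, Module.End.one_apply]

/-- CM currency: `θ_Φ(1, 1) = Σ_{ξ ∈ (L⁺)ⁿ} Φ(ξ)`, a convergent series. [cite: Weil1964, Chap. III n° 41 Thm 6 p. 193] -/
theorem cmThetaKernelDatum_hasSum_thetaFun_one (Φ : piSchwartzBruhat (↥(maximalRealSubfield L)) (Fin n)) :
    HasSum (fun ξ : Fin n → ↥(maximalRealSubfield L) =>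
        (Φ : (Fin n → AdeleRing (𝓞 ↥(maximalRealSubfield L)) ↥(maximalRealSubfield L)) → ℂ)
          (ratPt (↥(maximalRealSubfield L)) (Fin n) ξ))
      ((cmThetaKernelDatum L e dV hdV hdV0 dW hdW hdW0 hGR hρ SK hSK).thetaFun Φ 1) := by
  rw [cmThetaKernelDatum_thetaFun_one L e dV hdV hdV0 dW hdW hdW0 hGR hρ SK hSK]
  exact hasSum_thetaDist Φ.2

/-- CM currency, Gaussian: **`θ_{Φ_G}(1, 1) = Σ_{ξ ∈ 𝓞_{L⁺}ⁿ} e^{-Q(ξ)}`**. [cite: Weil1964, Chap. III n° 41 Thm 6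
p. 193; GelbartRogawski1991, §3.2 p. 457] -/
theorem cmThetaKernelDatum_thetaFun_gaussSB_one :
    (cmThetaKernelDatum L e dV hdV hdV0 dW hdW hdW0 hGR hρ SK hSK).thetaFun (gaussSB (↥(maximalRealSubfield L)) n) 1 =
      ∑' ζ : Fin n → 𝓞 ↥(maximalRealSubfield L), (Real.exp (-gaussNormSq (↥(maximalRealSubfield L)) n ζ) : ℂ) := by
  rw [cmThetaKernelDatum_thetaFun_one L e dV hdV hdV0 dW hdW hdW0 hGR hρ SK hSK]
  exact thetaDist_gaussSB_eq_tsum _ n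

/-- CM currency, Gaussian: convergence of the lattice theta series to `θ_{Φ_G}(1, 1)`. [cite: FleigEtAl2018, §12.4 Example 12.7, (12.45)–(12.48)] -/
theorem cmThetaKernelDatum_hasSum_thetaFun_gaussSB_one :
    HasSum (fun ζ : Fin n → 𝓞 ↥(maximalRealSubfield L) =>
        (Real.exp (-gaussNormSq (↥(maximalRealSubfield L)) n ζ) : ℂ))
      ((cmThetaKernelDatum L e dV hdV hdV0 dW hdW hdW0 hGR hρ SK hSK).thetaFun
        (gaussSB (↥(maximalRealSubfield L)) n) 1) := by
  rw [cmThetaKernelDatum_thetaFun_one L e dV hdV hdV0 dW hdW hdW0 hGR hρ SK hSK]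
  exact hasSum_thetaDist_gaussSB_int _ n

/-- CM currency, Gaussian: `Re θ_{Φ_G}(1, 1) ≥ 1`. [cite: FleigEtAl2018, §12.4 Example 12.7, (12.45)–(12.48)] -/
theorem cmThetaKernelDatum_one_le_re_thetaFun_gaussSB_one :
    1 ≤ ((cmThetaKernelDatum L e dV hdV hdV0 dW hdW hdW0 hGR hρ SK hSK).thetaFun
      (gaussSB (↥(maximalRealSubfield L)) n) 1).re := by
  rw [cmThetaKernelDatum_thetaFun_one L e dV hdV hdV0 dW hdW hdW0 hGR hρ SK hSK]
  exact one_le_re_thetaDist_gaussSB _ n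

/-- CM currency, Gaussian: **`θ_{Φ_G}(1, 1) ≠ 0`**. [cite: Weil1964, Chap. III n° 41 Thm 6 p. 193;
GelbartRogawski1991, §3.2 p. 457] -/
theorem cmThetaKernelDatum_thetaFun_gaussSB_one_ne_zero :
    (cmThetaKernelDatum L e dV hdV hdV0 dW hdW hdW0 hGR hρ SK hSK).thetaFun (gaussSB (↥(maximalRealSubfield L)) n) 1 ≠ 0 := by
  rw [cmThetaKernelDatum_thetaFun_one L e dV hdV hdV0 dW hdW hdW0 hGR hρ SK hSK]
  exact thetaDistLM_gaussSB_ne_zero _ n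

/-- CM currency: the descended kernel at the base point, `θ_{Φ_G}(1̄, 1̄) ≠ 0`. [cite: Weil1964, Chap. III n° 41 Thm 6 p. 193; GelbartRogawski1991, §3.2 p. 457] -/
theorem cmThetaKernelDatum_thetaKer_gaussSB_one_ne_zero :
    (cmThetaKernelDatum L e dV hdV hdV0 dW hdW hdW0 hGR hρ SK hSK).thetaKer (gaussSB (↥(maximalRealSubfield L)) n)
      (QuotientGroup.mk 1, QuotientGroup.mk 1) ≠ 0 := by
  rw [ThetaKernelDatum.thetaKer_apply, ThetaKernelDatum.thetaQuot_mk]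
  exact cmThetaKernelDatum_thetaFun_gaussSB_one_ne_zero L e dV hdV hdV0 dW hdW hdW0 hGR hρ SK hSK

variable
  [CompactSpace (↥(UnitaryGroup.adelic (↥(maximalRealSubfield L)) L (IsCMField.complexConj L) N (Matrix.diagonal dV)) ⧸
    (UnitaryGroup.toAdelic (↥(maximalRealSubfield L)) L (IsCMField.complexConj L) N (Matrix.diagonal dV)).range)]
  [CompactSpace (↥(UnitaryGroup.adelic (↥(maximalRealSubfield L)) L (IsCMField.complexConj L) M (Matrix.diagonal dW)) ⧸
    (UnitaryGroup.toAdelic (↥(maximalRealSubfield L)) L (IsCMField.complexConj L) M (Matrix.diagonal dW)).range)]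
  [MeasurableSpace (↥(UnitaryGroup.adelic (↥(maximalRealSubfield L)) L (IsCMField.complexConj L) M (Matrix.diagonal dW)) ⧸
    (UnitaryGroup.toAdelic (↥(maximalRealSubfield L)) L (IsCMField.complexConj L) M (Matrix.diagonal dW)).range)]
  [BorelSpace (↥(UnitaryGroup.adelic (↥(maximalRealSubfield L)) L (IsCMField.complexConj L) M (Matrix.diagonal dW)) ⧸
    (UnitaryGroup.toAdelic (↥(maximalRealSubfield L)) L (IsCMField.complexConj L) M (Matrix.diagonal dW)).range)]
  (μ : Measure (↥(UnitaryGroup.adelic (↥(maximalRealSubfield L)) L (IsCMField.complexConj L) M (Matrix.diagonal dW)) ⧸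
    (UnitaryGroup.toAdelic (↥(maximalRealSubfield L)) L (IsCMField.complexConj L) M (Matrix.diagonal dW)).range))
  [IsFiniteMeasure μ] [μ.IsOpenPosMeasure]

/-- CM currency: **a non-zero theta lift** — over compact quotients with `μ` finite and charging open sets,
`Θ_{Φ_G}(conj θ_{Φ_G}(1̄, ·))(1̄) = ∫ |θ_{Φ_G}(1̄, q)|² dμ ≠ 0`. [cite: FleigEtAl2018, §12.3 Definition 12.5 (12.37)] -/
theorem cmThetaKernelDatum_thetaLift_gaussSB_ne_zero :
    (cmThetaKernelDatum L e dV hdV hdV0 dW hdW hdW0 hGR hρ SK hSK).thetaLift μ (gaussSB (↥(maximalRealSubfield L)) n)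
      (star ((cmThetaKernelDatum L e dV hdV hdV0 dW hdW hdW0 hGR hρ SK hSK).thetaKerSlice
        (gaussSB (↥(maximalRealSubfield L)) n) (QuotientGroup.mk 1)))
      (QuotientGroup.mk 1) ≠ 0 :=
  ThetaKernelDatum.thetaLift_star_slice_ne_zero _ μ
    (cmThetaKernelDatum_thetaKer_gaussSB_one_ne_zero L e dV hdV hdV0 dW hdW hdW0 hGR hρ SK hSK)

end CM

/-! ## §4. The `U(1) × U(1)` instance -/

section U1U1

variable (L : Type) [Field L] [NumberField L] [IsCMField L] (e : Fin 1 × Fin 1 ≃ Fin 1)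

/-- `1̄ = 1` in the CM field (plumbing for the hermitian lines `⟨1⟩`). [folklore] -/
private theorem complexConj_one_vec : ∀ i : Fin 1, IsCMField.complexConj L ((1 : Fin 1 → L) i) = (1 : Fin 1 → L) i :=
  fun i => by rw [Pi.one_apply, map_one]

omit [NumberField L] [IsCMField L] in
/-- `1 ≠ 0` coordinatewise (plumbing for the hermitian lines `⟨1⟩`). [folklore] -/
private theorem one_vec_ne_zero : ∀ i : Fin 1, (1 : Fin 1 → L) i ≠ 0 := fun i => by
  rw [Pi.one_apply]; exact one_ne_zero

variable (hGR : (cmSplittingDatum L e 1 (complexConj_one_vec L) (one_vec_ne_zero L)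
    1 (complexConj_one_vec L) (one_vec_ne_zero L)).CompatibleSplitting)
  (hρ : HasThetaMajorants fun
    (p : ↥(UnitaryGroup.adelic (↥(maximalRealSubfield L)) L (IsCMField.complexConj L) 1 (Matrix.diagonal 1)) ×
      ↥(UnitaryGroup.adelic (↥(maximalRealSubfield L)) L (IsCMField.complexConj L) 1 (Matrix.diagonal 1)))
    (Φ : piSchwartzBruhat (↥(maximalRealSubfield L)) (Fin 1)) =>
      adelicMpCont.omega (↥(maximalRealSubfield L)) (Fin 1)
        (adelicGram (↥(maximalRealSubfield L)) e (realDiagonal L 1 (complexConj_one_vec L))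
          (realDiagonal L 1 (complexConj_one_vec L)))
        (cmPairSplitting L e 1 (complexConj_one_vec L) (one_vec_ne_zero L) 1 (complexConj_one_vec L)
          (one_vec_ne_zero L) hGR p) Φ)
  (SK : Set (piSchwartzBruhat (↥(maximalRealSubfield L)) (Fin 1)))
  (hSK : ∀ (h : ↥(UnitaryGroup.adelic (↥(maximalRealSubfield L)) L (IsCMField.complexConj L) 1 (Matrix.diagonal 1)))
    (Φ : piSchwartzBruhat (↥(maximalRealSubfield L)) (Fin 1)), Φ ∈ SK →
      cmPairRep L e 1 (complexConj_one_vec L) (one_vec_ne_zero L) 1 (complexConj_one_vec L) (one_vec_ne_zero L)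
        hGR (1, h) Φ ∈ SK)

/-- **The `U(1) × U(1)` theta kernel of the Gaussian at the identity is the classical theta series of the norm
form on `𝓞_{L⁺}`**: for the dual pair of the hermitian lines `⟨1⟩`, `⟨1⟩` over the CM extension `L/L⁺`
(`N = M = 1`, `𝕏 = L⁺`), `θ_{Φ_G}(1, 1) = Σ_{ξ ∈ 𝓞_{L⁺}} e^{-Q(ξ)}`, `Q(ξ) = ‖T j(ξ)‖²` (FGKP Example 12.7, the
simplest case `V(F) ≅ F`: global theta series of the Gaussian = classical Jacobi theta series).
[cite: FleigEtAl2018, §12.4 Example 12.7, (12.44)–(12.48)] -/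
theorem cmThetaKernelDatum_U1U1_thetaFun_gaussSB_one :
    (cmThetaKernelDatum L e 1 (complexConj_one_vec L) (one_vec_ne_zero L) 1 (complexConj_one_vec L)
        (one_vec_ne_zero L) hGR hρ SK hSK).thetaFun (gaussSB (↥(maximalRealSubfield L)) 1) 1 =
      ∑' ζ : Fin 1 → 𝓞 ↥(maximalRealSubfield L), (Real.exp (-gaussNormSq (↥(maximalRealSubfield L)) 1 ζ) : ℂ) :=
  cmThetaKernelDatum_thetaFun_gaussSB_one L e 1 (complexConj_one_vec L) (one_vec_ne_zero L) 1
    (complexConj_one_vec L) (one_vec_ne_zero L) hGR hρ SK hSK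

/-- **… convergent**: `HasSum (ξ ↦ e^{-Q(ξ)}) θ_{Φ_G}(1, 1)` over `𝓞_{L⁺}`. [cite: FleigEtAl2018, §12.4 Example 12.7, (12.45)–(12.48)] -/
theorem cmThetaKernelDatum_U1U1_hasSum_thetaFun_gaussSB_one :
    HasSum (fun ζ : Fin 1 → 𝓞 ↥(maximalRealSubfield L) =>
        (Real.exp (-gaussNormSq (↥(maximalRealSubfield L)) 1 ζ) : ℂ))
      ((cmThetaKernelDatum L e 1 (complexConj_one_vec L) (one_vec_ne_zero L) 1 (complexConj_one_vec L)
        (one_vec_ne_zero L) hGR hρ SK hSK).thetaFun (gaussSB (↥(maximalRealSubfield L)) 1) 1) :=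
  cmThetaKernelDatum_hasSum_thetaFun_gaussSB_one L e 1 (complexConj_one_vec L) (one_vec_ne_zero L) 1
    (complexConj_one_vec L) (one_vec_ne_zero L) hGR hρ SK hSK

/-- **… and non-zero**: `θ_{Φ_G}(1, 1) ≠ 0` for the `U(1) × U(1)` pair. [cite: Weil1964, Chap. III n° 41 Thm 6
p. 193; GelbartRogawski1991, §3.2 p. 457] -/
theorem cmThetaKernelDatum_U1U1_thetaFun_gaussSB_one_ne_zero :
    (cmThetaKernelDatum L e 1 (complexConj_one_vec L) (one_vec_ne_zero L) 1 (complexConj_one_vec L)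
        (one_vec_ne_zero L) hGR hρ SK hSK).thetaFun (gaussSB (↥(maximalRealSubfield L)) 1) 1 ≠ 0 :=
  cmThetaKernelDatum_thetaFun_gaussSB_one_ne_zero L e 1 (complexConj_one_vec L) (one_vec_ne_zero L) 1
    (complexConj_one_vec L) (one_vec_ne_zero L) hGR hρ SK hSK

/-- … descended to `[U(1)] × [U(1)]`: `θ_{Φ_G}(1̄, 1̄) ≠ 0`. [cite: Weil1964, Chap. III n° 41 Thm 6 p. 193; GelbartRogawski1991, §3.2 p. 457] -/
theorem cmThetaKernelDatum_U1U1_thetaKer_gaussSB_one_ne_zero :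
    (cmThetaKernelDatum L e 1 (complexConj_one_vec L) (one_vec_ne_zero L) 1 (complexConj_one_vec L)
        (one_vec_ne_zero L) hGR hρ SK hSK).thetaKer (gaussSB (↥(maximalRealSubfield L)) 1)
      (QuotientGroup.mk 1, QuotientGroup.mk 1) ≠ 0 :=
  cmThetaKernelDatum_thetaKer_gaussSB_one_ne_zero L e 1 (complexConj_one_vec L) (one_vec_ne_zero L) 1
    (complexConj_one_vec L) (one_vec_ne_zero L) hGR hρ SK hSK

/-- `Re θ_{Φ_G}(1, 1) ≥ 1` for the `U(1) × U(1)` pair (positivity of the real theta series). [cite: FleigEtAl2018, §12.4 Example 12.7, (12.45)–(12.48)] -/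
theorem cmThetaKernelDatum_U1U1_one_le_re_thetaFun_gaussSB_one :
    1 ≤ ((cmThetaKernelDatum L e 1 (complexConj_one_vec L) (one_vec_ne_zero L) 1 (complexConj_one_vec L)
        (one_vec_ne_zero L) hGR hρ SK hSK).thetaFun (gaussSB (↥(maximalRealSubfield L)) 1) 1).re :=
  cmThetaKernelDatum_one_le_re_thetaFun_gaussSB_one L e 1 (complexConj_one_vec L) (one_vec_ne_zero L) 1
    (complexConj_one_vec L) (one_vec_ne_zero L) hGR hρ SK hSK

/-! ### The `U(1) × U(1)` datum modulo the one cited hypothesis `hGR` -/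

omit [NumberField L] [IsCMField L] in
/-- `re τ(1) = 1 > 0` through every complex embedding (the lines `⟨1⟩` are definite everywhere). [folklore] -/
private theorem re_apply_one_vec_pos (τ : L →+* ℂ) (j : Fin 1) : 0 < (τ ((1 : Fin 1 → L) j)).re := by
  rw [Pi.one_apply, map_one, Complex.one_re]
  exact one_pos

/-- **Weil's majorants for the `U(1) × U(1)` pair are supplied by the tree**: the hypothesis `hρ` of
`cmThetaKernelDatum` for the lines `⟨1⟩`, `⟨1⟩`, from the sign-fact producer
`Weil1964.hasThetaMajorants_cmPairSplitting_of_signs` (through every complex embedding `τ(1) = 1 > 0`, and for a rank-one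
space the "all but one index" sign conditions are vacuous). [cite: Weil1964, Chap. III n° 41 Lemme 5 p. 194, Théorème 6 (1)
p. 193; GelbartRogawski1991, §3.1 Prop. 3.1.1 p. 455] -/
theorem hasThetaMajorants_cmPairSplitting_U1U1 :
    HasThetaMajorants fun
      (p : ↥(UnitaryGroup.adelic (↥(maximalRealSubfield L)) L (IsCMField.complexConj L) 1 (Matrix.diagonal 1)) ×
        ↥(UnitaryGroup.adelic (↥(maximalRealSubfield L)) L (IsCMField.complexConj L) 1 (Matrix.diagonal 1)))
      (Φ : piSchwartzBruhat (↥(maximalRealSubfield L)) (Fin 1)) =>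
        adelicMpCont.omega (↥(maximalRealSubfield L)) (Fin 1)
          (adelicGram (↥(maximalRealSubfield L)) e (realDiagonal L 1 (complexConj_one_vec L))
            (realDiagonal L 1 (complexConj_one_vec L)))
          (cmPairSplitting L e 1 (complexConj_one_vec L) (one_vec_ne_zero L) 1 (complexConj_one_vec L)
            (one_vec_ne_zero L) hGR p) Φ :=
  (inferInstance : Nonempty (L →+* ℂ)).elim fun ι₁ =>
    hasThetaMajorants_cmPairSplitting_of_signs L e 1 (complexConj_one_vec L) (one_vec_ne_zero L) 1
      (complexConj_one_vec L) (one_vec_ne_zero L) ι₁ hGR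
      ⟨0, Or.inl fun i hi => absurd (Subsingleton.elim i 0) hi⟩ (Or.inl (re_apply_one_vec_pos L ι₁))
      (fun τ _ => Or.inl (re_apply_one_vec_pos L τ)) fun _ _ => Or.inl ⟨0, fun j hj => absurd (Subsingleton.elim j 0) hj⟩

/-- **The `U(1) × U(1)` theta kernel of the Gaussian at the identity, modulo `hGR` only** (majorants from the tree,
`SK := univ`): `θ_{Φ_G}(1, 1) = Σ_{ξ ∈ 𝓞_{L⁺}} e^{-Q(ξ)}`. [cite: FleigEtAl2018, §12.4 Example 12.7, (12.44)–(12.48)] -/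
theorem cmThetaKernelDatum_U1U1_univ_thetaFun_gaussSB_one :
    (cmThetaKernelDatum L e 1 (complexConj_one_vec L) (one_vec_ne_zero L) 1 (complexConj_one_vec L)
        (one_vec_ne_zero L) hGR (hasThetaMajorants_cmPairSplitting_U1U1 L e hGR) Set.univ
        (fun _ _ _ => Set.mem_univ _)).thetaFun (gaussSB (↥(maximalRealSubfield L)) 1) 1 =
      ∑' ζ : Fin 1 → 𝓞 ↥(maximalRealSubfield L), (Real.exp (-gaussNormSq (↥(maximalRealSubfield L)) 1 ζ) : ℂ) :=
  cmThetaKernelDatum_thetaFun_gaussSB_one L e 1 (complexConj_one_vec L) (one_vec_ne_zero L) 1 (complexConj_one_vec L)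
    (one_vec_ne_zero L) hGR (hasThetaMajorants_cmPairSplitting_U1U1 L e hGR) Set.univ fun _ _ _ => Set.mem_univ _

/-- **… convergent** (modulo `hGR` only). [cite: FleigEtAl2018, §12.4 Example 12.7, (12.45)–(12.48)] -/
theorem cmThetaKernelDatum_U1U1_univ_hasSum_thetaFun_gaussSB_one :
    HasSum (fun ζ : Fin 1 → 𝓞 ↥(maximalRealSubfield L) =>
        (Real.exp (-gaussNormSq (↥(maximalRealSubfield L)) 1 ζ) : ℂ))
      ((cmThetaKernelDatum L e 1 (complexConj_one_vec L) (one_vec_ne_zero L) 1 (complexConj_one_vec L)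
        (one_vec_ne_zero L) hGR (hasThetaMajorants_cmPairSplitting_U1U1 L e hGR) Set.univ
        (fun _ _ _ => Set.mem_univ _)).thetaFun (gaussSB (↥(maximalRealSubfield L)) 1) 1) :=
  cmThetaKernelDatum_hasSum_thetaFun_gaussSB_one L e 1 (complexConj_one_vec L) (one_vec_ne_zero L) 1
    (complexConj_one_vec L) (one_vec_ne_zero L) hGR (hasThetaMajorants_cmPairSplitting_U1U1 L e hGR) Set.univ
    fun _ _ _ => Set.mem_univ _

/-- **… and non-zero** (modulo `hGR` only): the `U(1) × U(1)` theta kernel built from [GelbartRogawski1991, Prop. 3.1.1]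
alone does not vanish at the identity on the Gaussian. [cite: Weil1964, Chap. III n° 41 Thm 6 p. 193;
GelbartRogawski1991, §3.2 p. 457] -/
theorem cmThetaKernelDatum_U1U1_univ_thetaFun_gaussSB_one_ne_zero :
    (cmThetaKernelDatum L e 1 (complexConj_one_vec L) (one_vec_ne_zero L) 1 (complexConj_one_vec L)
        (one_vec_ne_zero L) hGR (hasThetaMajorants_cmPairSplitting_U1U1 L e hGR) Set.univ
        (fun _ _ _ => Set.mem_univ _)).thetaFun (gaussSB (↥(maximalRealSubfield L)) 1) 1 ≠ 0 :=
  cmThetaKernelDatum_thetaFun_gaussSB_one_ne_zero L e 1 (complexConj_one_vec L) (one_vec_ne_zero L) 1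
    (complexConj_one_vec L) (one_vec_ne_zero L) hGR (hasThetaMajorants_cmPairSplitting_U1U1 L e hGR) Set.univ
    fun _ _ _ => Set.mem_univ _

/-- … descended to `[U(1)] × [U(1)]` (modulo `hGR` only): `θ_{Φ_G}(1̄, 1̄) ≠ 0`. [cite: Weil1964, Chap. III n° 41 Thm 6
p. 193; GelbartRogawski1991, §3.2 p. 457] -/
theorem cmThetaKernelDatum_U1U1_univ_thetaKer_gaussSB_one_ne_zero :
    (cmThetaKernelDatum L e 1 (complexConj_one_vec L) (one_vec_ne_zero L) 1 (complexConj_one_vec L)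
        (one_vec_ne_zero L) hGR (hasThetaMajorants_cmPairSplitting_U1U1 L e hGR) Set.univ
        (fun _ _ _ => Set.mem_univ _)).thetaKer (gaussSB (↥(maximalRealSubfield L)) 1)
      (QuotientGroup.mk 1, QuotientGroup.mk 1) ≠ 0 :=
  cmThetaKernelDatum_thetaKer_gaussSB_one_ne_zero L e 1 (complexConj_one_vec L) (one_vec_ne_zero L) 1
    (complexConj_one_vec L) (one_vec_ne_zero L) hGR (hasThetaMajorants_cmPairSplitting_U1U1 L e hGR) Set.univ
    fun _ _ _ => Set.mem_univ _

end U1U1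

/-! ### Build-lane note (ops-buildfix G11b-3, 2026-08-21)
`lake build` (`lean -o`) of this module never finished on the hub build lane: at `.olean` export the
library-suggestion indexers of Lean 4.32 (`Lean.LibrarySuggestions.SymbolFrequency` / `SineQuaNon`,
run from their `exportEntriesFn`, hence only under `-o` and never under `lean` / the gate check) fold
`Lean.Expr.foldRelevantConstants` over the statement of every local theorem that is not a denied
premise; on the theorems of this file (statements that unfold to ≈10⁹-node trees through the
theta-kernel data) that fold does not terminate for hours (`getFunInfo`/`collectDeps` walk the
types as trees; no heartbeat limit applies at export). `Lean.LibrarySuggestions.isDeniedPremise`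
skips `[implicit_reducible]` constants before any fold, and a reducibility status on a *theorem*
is inert (Meta unfolds theorems only at transparency `.all`; the kernel ignores the attribute), so
the public theorems of this file are tagged `[implicit_reducible]` purely to keep them out of that
index. Only other effect: they are not offered by `+suggestions` premise selectors downstream.
No statement or proof is changed. Details: run/shared/lean/ops/buildfix/G11b-3-DOSSIER.md §ROOT CAUSE;
this line is superseded if the operator later lands the deny-list form (OPERATOR-LAND-G11b3.sh or
`HarnessLib.PremiseIndex`), after which it may be dropped in the same maintenance edit. -/
set_option allowUnsafeReducibility true in
attribute [implicit_reducible]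
  thetaKernelDatum_thetaFun_one thetaKernelDatum_thetaFun_one_eq_tsum
  thetaKernelDatum_hasSum_thetaFun_one thetaKernelDatum_thetaFun_gaussSB_one
  thetaKernelDatum_hasSum_thetaFun_gaussSB_one one_le_re_thetaKernelDatum_thetaFun_gaussSB_one
  thetaKernelDatum_thetaFun_gaussSB_one_ne_zero thetaKernelDatum_thetaKer_gaussSB_one_ne_zero
  thetaKernelDatum_thetaLift_gaussSB_ne_zero cmThetaKernelDatum_thetaFun_one
  cmThetaKernelDatum_hasSum_thetaFun_one cmThetaKernelDatum_thetaFun_gaussSB_one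
  cmThetaKernelDatum_hasSum_thetaFun_gaussSB_one cmThetaKernelDatum_one_le_re_thetaFun_gaussSB_one
  cmThetaKernelDatum_thetaFun_gaussSB_one_ne_zero cmThetaKernelDatum_thetaKer_gaussSB_one_ne_zero
  cmThetaKernelDatum_thetaLift_gaussSB_ne_zero cmThetaKernelDatum_U1U1_thetaFun_gaussSB_one
  cmThetaKernelDatum_U1U1_hasSum_thetaFun_gaussSB_one
  cmThetaKernelDatum_U1U1_thetaFun_gaussSB_one_ne_zero
  cmThetaKernelDatum_U1U1_thetaKer_gaussSB_one_ne_zero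
  cmThetaKernelDatum_U1U1_one_le_re_thetaFun_gaussSB_one hasThetaMajorants_cmPairSplitting_U1U1
  cmThetaKernelDatum_U1U1_univ_thetaFun_gaussSB_one
  cmThetaKernelDatum_U1U1_univ_hasSum_thetaFun_gaussSB_one
  cmThetaKernelDatum_U1U1_univ_thetaFun_gaussSB_one_ne_zero
  cmThetaKernelDatum_U1U1_univ_thetaKer_gaussSB_one_ne_zero

end UnitaryDualPair

end Literature.NumberTheory.GelbartRogawski1991

end

-- buildfix 2026-08-21 (ops-buildfix-2): comment-only re-land to re-queue the hub build of this module
-- (accepted 06:40-07:30Z but never dispatched to the build lane, HOME LEDGER G11b-3); no declaration changed.
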